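import Summits.QuantumFields.YangMills.Theorems.BalabanUVNodesK2V6Defs
import Summits.QuantumFields.YangMills.Theorems.BalabanUVNodesK2CornerRoad
import Summits.QuantumFields.BalabanUV.Gaps.CapTailPinnedLimitSign

/-!
# Crux K2⁷ `EndpointGivenBR13SepCoPH` (stmt-QuantumFields-20543) — THE HYPOTHESIS-FREE LIMIT OF THE NAMED ONE-LOOP NUMBERS `beta0OfJs F κ`, AND WHAT IT MAKES OF
# v6's REGISTERED (D1) STUB `stub_d1AnchoredJets13 : D1AtAnchoredJets` BY NAME: the stub ⟺ «every colour datum ANCHORING a prefixed admissible record lies on the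
# drift variety `CauchyRate.lim (beta0OfJs F κ) = stepBal 2 F.L`»; its dealt use form `d1AtAnchoredJets_of_d1Drift_all` ⟺ TOTAL COLOUR-BLINDNESS of that limit; v6's
# PAIR ⟺ ONE ∃κ text concluding the crux decl BY NAME; the pinned and the sign keyings

Cell `ym-nodeO-ideate`, seat `ym-nodeO-d1-w1` (gen 0; director-ym R399 (3a) ∕ №207: «land `stub_d1AnchoredJets13 : D1AtAnchoredJets` via `d1AtAnchoredJets_of_d1Drift_all`»;
dag-lead GATE v1.57 DEAL).  `--kind proof --supports stmt-QuantumFields-20543 --as helper`; count-neutral.  = PORT-2 of idea-7's crux workfile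
`Cruxes/EndpointGivenBR13SepCoPH/CornerLimitSignSketch.lean` EDITION 4 §9 (9.1 ∕ 9.2a–d ∕ 9.3a–e ∕ 9.4a–c; CRIT-2 ROUND 4 «SURVIVES priced … located finding UPHELD»; HOME
STATUS S.1681 (ii) «PORT-2 … so a v7 can merge or pin by `exact`»), RE-KEYED TO THE TREE: the two registered texts are DEF-1's `K2V6Defs.D1AtAnchoredJets` (1ᴬ) ∕
`K2V6Defs.RunRemAtSomeJets` (2ᴮ″) BY NAME (byte-identical to v6 5a75a2378c79b303 :330 ∕ :319, `K2V6Defs.d1AtAnchoredJets_iff_inline`), idea-7's `limOfJs F κ` is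
INLINED as `CauchyRate.lim (beta0OfJs F κ)`, the sign road is PORT-1's `K2CornerRoad.EndpointGivenBR13SepCoPH_of_u3K_anchorK_signK` BY NAME.  0 `def`.

WHY.  The dealt use form (v6 :369, tree `K2V6Defs.d1AtAnchoredJets_of_drift_of_anchor` with the anchor discarded) asks `∀ F κ, ∃ A, OneLoopDrift (stepBal 2 F.L) A (beta0OfJs F κ)`.
Two TREE facts decide the shape of everything here, HYPOTHESIS-FREE, for EVERY family `F` and EVERY colour datum `κ` (gan24-p1's all-scales rate through g1-p3's
`Gaps.CapTailPinnedLimitSign` at `Lc := F.L`, root `ctrOff (3+1) F.L`, channel `(0,1)`; `JsOfRecord F κ` IS the pinned literal `JsBalAn1Ctr …` by `rfl`):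
(i) `tendsto_beta0OfJs` — the named numbers CONVERGE to `CauchyRate.lim (beta0OfJs F κ)`; (ii) `drift_iff_lim_eq` — `(∃ A, OneLoopDrift (stepBal N F.L) A (beta0OfJs F κ)) ⟺
CauchyRate.lim (beta0OfJs F κ) = stepBal N F.L` (`d1Drift_pinned_iff_lim_eq`).  Consequences, all kernel-checked against the REGISTERED texts BY NAME:
* §2 ★ `d1AtAnchoredJets_iff_anchoredOnVariety` — 1ᴬ ⟺ «at every tuple carrying the crux's prefix, every κ whose `θ.cβ`-scaled numbers ANCHOR the record's β has
  `CauchyRate.lim (beta0OfJs F κ) = stepBal 2 F.L`» (idea-7's `UVNamable13K`, N17-FREE — compare dag-n17-w1's `…N17D1OfNamedLimit.d1AtAnchoredJets_iff_limitAtAnchoredJets_of_n17AtRecord13`,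
  which needs the `N17AtRecord13` text for the convergence that (i) gives for free); equivalently (`…_iff_tendstoAtAnchoredJets`) «… `beta0OfJs F κ → stepBal 2 F.L`»; and, at tuples
  where SOME κ anchors, ⟺ the JETS-FREE corner value «every sequence anchoring the record's β tends to `θ.cβ · stepBal 2 F.L`» (`…_of_universalCornerValue` ∕ `universalCornerValue_of_…`).
  A statement about WHICH colour data name def-T's records: its only record-free sufficient condition is `d1DriftAll_iff_colourBlind` — the dealt use form's hypothesis ⟺
  `∀ F κ, CauchyRate.lim (beta0OfJs F κ) = stepBal 2 F.L` (the pinned family's limit `γ_r + Φ(c⃗) + cB·σ_r + Λ(Tc)`, `Gaps.D1PinnedColourPolynomial.lim_normalForm_universal`,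
  CONSTANT on `ℝ³ × ℝ × ℝ²⁵⁶` — no coefficient certified either way in the tree); KILL-TARGETS for a compute desk: `not_d1DriftAll_of_lim_ne` (ONE off-variety value) ∕
  `not_d1DriftAll_of_lim_ne_lim` (TWO distinct limits in one family) ⟹ the dealt road is dead for good.
* §3 ★ `stubTexts_iff_runRemAtOnVariety` — v6's PAIR (1ᴬ ∧ 2ᴮ″) ⟺ ONE ∃κ text «prefix → ∃ κ, CauchyRate.lim (beta0OfJs F κ) = stepBal 2 F.L ∧ RunRemAt F κ θ hP θ.cβ» (anchor
  uniqueness `ScaleAnchor.eq_of_smul` at `θ.cβ ≠ 0`); ★★ `EndpointGivenBR13SepCoPH_of_runRemAtOnVariety` concludes THE CRUX DECL BY NAME (`K2V6Defs.EndpointGivenBR13SepCoPH_of_stubTexts`);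
  `pinnedD1_iff_lim_eq` — CRIT-2 ROUND 4's re-deal (b) stub `∀ F, ∃ A, OneLoopDrift (stepBal 2 F.L) A (beta0OfJs F (κ⋆ F.L))` IS one real identity per block `L`;
  `d1AtAnchoredJets_of_pinOnVariety` ∕ `runRemAtOnVariety_of_pin` (the pinned keying ⟹ 1ᴬ ∕ the merged text; the pin's identification half is record content).
* §4 the SIGN keying over PORT-1's road: `signK_of_d1AtAnchoredJets` (1ᴬ ⟹ PORT-1's Signᴷ text WITHOUT U3ᴷ — PORT-1's `signK_of_u3K_d1AnchoredK` needed U3ᴷ only for the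
  convergence (i) supplies), `signK_of_anchorPositiveK`, ★★ `EndpointGivenBR13SepCoPH_of_u3K_anchorPositiveK` (U3ᴷ → «∃ κ, 0 < lim ∧ anchor» → crux decl BY NAME),
  `anchorPositiveK_iff_anchorSomeK_and_cornerSign`, `anchorPositiveK_of_runRemAtOnVariety` ∕ `…_of_stubTexts` (value ⟹ sign).
HONEST FRAMING.  Elementary real analysis + bookkeeping BY NAME over tree theorems; NOTHING of Bałaban's analysis is asserted; `stub_d1AnchoredJets13` is NOT proved here (this file
proves what it IS, not THAT it holds); (D1) is NOT discharged at any colour datum and NO coefficient of the colour polynomial is certified; (P6) — which κ is print's — NOT decided;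
K2⁷ stmt-QuantumFields-20543 OPEN (v6: 2 registered stubs, 0 closed); counts UNMOVED (typed 28∕28 · discharged 5∕27 (A 5∕28)); every text below quantifies over
`θ : Node00.Stage13HParams F 2` with `θ.Provisos₁₃SepCoPH F 2` under the crux's prefix — inhabited iff K0⁷ ∧ K1⁷-type statements hold (both open).  [Balaban1987RG1] Thm 2 + (0.31)
p. 259 (NODE O) is UNPROVED IN PRINT.  One finite 𝕋⁴ programme at fixed `ε = L^{−K}`; route R4 closes the CONDITIONAL finite-𝕋⁴ rung `BalabanLadder.UV` only — NOT the continuum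
limit, NOT ℝ⁴, NOT OS, NOT a mass gap; the Yang–Mills mass gap (Clay) is NOT proved by any of this; no summit statement is proved by this seat.  No `def`, no `instance`, no
`notation`, no `axiom`, 0 `sorry`.  Sources (context only; nothing printed is used as a hypothesis): [I] = [Balaban1987RG1] CMP **109** (1987): Thm 2 p. 259, (1.3) p. 260,
(1.20)–(1.22) p. 264, Thm 3 p. 264, (2.12)–(2.14) p. 268, (5.10) p. 293; (0.20) p. 256 (`stepBal`).
-/

noncomputable section

namespace Summit.QuantumFields.YangMills.Theorems.BalabanUVNodesK2NamedJetsLimit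

open Filter Topology
open Literature.MathematicalPhysics.QuantumFieldTheory.Balaban1983to89
open Literature.MathematicalPhysics.QuantumFieldTheory.Balaban1983to89.T4Continuum (T4Family)
open Literature.MathematicalPhysics.QuantumFieldTheory.Balaban1983to89.T4CouplingMatching (ScaleShiftRate HistLipschitz)
open Literature.MathematicalPhysics.QuantumFieldTheory.Balaban1983to89.Beta.Drift (OneLoopDrift)
open Literature.MathematicalPhysics.QuantumFieldTheory.Balaban1983to89.Beta.RateCertificate (CauchyRate)
open Literature.MathematicalPhysics.QuantumFieldTheory.Balaban1983to89.Beta.AveragingContoursRooted (ctrOff_mem_box)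
open Summit.QuantumFields.YangMills.Theorems.BalabanUVNodesK2JsOfRecord (StepColourData JsOfRecord beta0OfJs d1Drift_JsOfRecord_iff stepBal_L_pos)
open Summit.QuantumFields.YangMills.Theorems.BalabanUVNodesK2NamedJetsRemAt (ScaleAnchor)
open Summit.QuantumFields.YangMills.Theorems.BalabanUVNodesK2NamedJetsRunRemAt (RunRemAt)
open Summit.QuantumFields.YangMills.Theorems.BalabanUVNodesK2V6Defs (Window13 D1AtAnchoredJets RunRemAtSomeJets EndpointGivenBR13SepCoPH_of_stubTexts
  d1AtAnchoredJets_of_drift_of_anchor)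
open Summit.QuantumFields.YangMills.Theorems.BalabanUVNodesK2CornerRoad (EndpointGivenBR13SepCoPH_of_u3K_anchorK_signK)
open Summit.QuantumFields.BalabanUV.Gaps.CapTailPinnedLimitSign (tendsto_pinned d1Drift_pinned_iff_lim_eq)

/-! ## §1 The tree's HYPOTHESIS-FREE limit of the named one-loop numbers (every family, every colour datum) and the anchor's uniqueness -/

section Limit

variable (F : T4Family) (κ : StepColourData)

/-- `2 ≤ F.L` — the family's block (`T4Family.hL : Odd L ∧ 1 < L`). [folklore] -/
theorem two_le_L : 2 ≤ F.L := F.hL.2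
/-- **THE NAMED ONE-LOOP NUMBERS CONVERGE, HYPOTHESIS-FREE**: `beta0OfJs F κ → CauchyRate.lim (beta0OfJs F κ)` for EVERY family and EVERY colour datum — g1-p3's
`CapTailPinnedLimitSign.tendsto_pinned` (gan24-p1's all-scales rate) at `Lc := F.L`, root `ctrOff (3+1) F.L`, channel `(0,1)`; `beta0OfJs` ∕ `JsOfRecord` ∕ `JsBalAn1Ctr` unfold to the
pinned literal by `rfl`.  (idea-7 §9.1 `tendsto_beta0OfJs`, `limOfJs` inlined.) [folklore] -/
theorem tendsto_beta0OfJs : Tendsto (beta0OfJs F κ) atTop (𝓝 (CauchyRate.lim (beta0OfJs F κ))) := by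
  haveI : NeZero F.L := ⟨by have := F.hL.2; omega⟩
  exact tendsto_pinned (two_le_L F) (ctrOff_mem_box F.hL.2.le) κ.cE κ.cVH κ.cΛ κ.cB κ.Tc 0 1

/-- **ROW (D1) AT THE NAMED JETS IS THE EVALUATION OF ONE REAL NUMBER — HYPOTHESIS-FREE, at every numeral `N`**:
`(∃ A, OneLoopDrift (stepBal N F.L) A (beta0OfJs F κ)) ⟺ CauchyRate.lim (beta0OfJs F κ) = stepBal N F.L` (DEF-1's `d1Drift_JsOfRecord_iff` (`Iff.rfl`) + g1-p3's
`d1Drift_pinned_iff_lim_eq`).  (idea-7 §9.1 `drift_iff_limOfJs_eq`.) [folklore] -/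
theorem drift_iff_lim_eq (N : ℝ) :
    (∃ A : ℝ, OneLoopDrift (B12Normalization.stepBal N F.L) A (beta0OfJs F κ)) ↔ CauchyRate.lim (beta0OfJs F κ) = B12Normalization.stepBal N F.L := by
  haveI : NeZero F.L := ⟨by have := F.hL.2; omega⟩
  exact (d1Drift_JsOfRecord_iff F κ N).symm.trans (d1Drift_pinned_iff_lim_eq (two_le_L F) (ctrOff_mem_box F.hL.2.le) κ.cE κ.cVH κ.cΛ κ.cB κ.Tc 0 1 N)

/-- … equivalently, by (i) and uniqueness of limits: `(∃ A, OneLoopDrift (stepBal N F.L) A (beta0OfJs F κ)) ⟺ beta0OfJs F κ → stepBal N F.L`. [folklore] -/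
theorem drift_iff_tendsto_stepBal (N : ℝ) :
    (∃ A : ℝ, OneLoopDrift (B12Normalization.stepBal N F.L) A (beta0OfJs F κ)) ↔ Tendsto (beta0OfJs F κ) atTop (𝓝 (B12Normalization.stepBal N F.L)) := by
  rw [drift_iff_lim_eq]
  refine ⟨fun h => ?_, fun h => tendsto_nhds_unique (tendsto_beta0OfJs F κ) h⟩
  rw [← h]
  exact tendsto_beta0OfJs F κ

/-- a POSITIVE limit gives the eventual floor `lim ∕ 2`. [folklore] -/
theorem eventuallyFloor_of_lim_pos (h : 0 < CauchyRate.lim (beta0OfJs F κ)) :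
    ∃ k₀ : ℕ, ∀ k, k₀ ≤ k → CauchyRate.lim (beta0OfJs F κ) / 2 ≤ beta0OfJs F κ k :=
  Filter.eventually_atTop.mp ((tendsto_beta0OfJs F κ).eventually (eventually_ge_nhds (half_lt_self h)))

/-- … in the shape of PORT-1's Signᴷ conclusion: `∃ e > 0, ∃ k₀, ∀ k ≥ k₀, e ≤ beta0OfJs F κ k`. [folklore] -/
theorem eventuallyPos_of_lim_pos (h : 0 < CauchyRate.lim (beta0OfJs F κ)) :
    ∃ e : ℝ, 0 < e ∧ ∃ k₀ : ℕ, ∀ k, k₀ ≤ k → e ≤ beta0OfJs F κ k :=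
  ⟨_, half_pos h, eventuallyFloor_of_lim_pos F κ h⟩

/-- **A DRIFT WITH BAŁABAN's SLOPE MAKES THE NAMED NUMBERS EVENTUALLY POSITIVE — with NO rate letter** (drift ⟹ `lim = stepBal 2 F.L > 0` ⟹ floor; PORT-1's
`eventuallyPos_of_letters_scaleAnchor_drift` needed a `ScaleShiftRate` letter for the convergence that (i) supplies). [folklore] -/
theorem eventuallyPos_of_drift {A : ℝ} (h : OneLoopDrift (B12Normalization.stepBal 2 F.L) A (beta0OfJs F κ)) :
    ∃ e : ℝ, 0 < e ∧ ∃ k₀ : ℕ, ∀ k, k₀ ≤ k → e ≤ beta0OfJs F κ k := by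
  apply eventuallyPos_of_lim_pos
  rw [(drift_iff_lim_eq F κ 2).mp ⟨A, h⟩]
  exact stepBal_L_pos F two_pos

/-- at a non-zero scale `cβ`: `cβ • beta0OfJs F κ → cβ · s` forces `CauchyRate.lim (beta0OfJs F κ) = s`. [folklore] -/
theorem lim_eq_of_tendsto_smul {cβ s : ℝ} (hcβ : cβ ≠ 0) (h : Tendsto (fun k => cβ * beta0OfJs F κ k) atTop (𝓝 (cβ * s))) :
    CauchyRate.lim (beta0OfJs F κ) = s :=
  mul_left_cancel₀ hcβ (tendsto_nhds_unique ((tendsto_beta0OfJs F κ).const_mul cβ) h)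

end Limit

section Anchors
variable {F : T4Family} {κ κ' : StepColourData} {θ : Node00.Stage13HParams F 2} {hP : θ.Provisos₁₃SepCoPH F 2}

/-- two colour data whose `θ.cβ`-scaled numbers anchor the SAME admissible record have the same named numbers (DEF-1's `ScaleAnchor.eq_of_smul`; `θ.cβ ≠ 0` is Stage-9
admissibility's chart clause) … [folklore] -/
theorem beta0OfJs_eq_of_anchors (hθ : θ.Admissible F 2)
    (h : ScaleAnchor (Node00.datumOfRecord₁₃SepCoPH F 2 θ hP).βfun (fun k => θ.cβ * beta0OfJs F κ k))
    (h' : ScaleAnchor (Node00.datumOfRecord₁₃SepCoPH F 2 θ hP).βfun (fun k => θ.cβ * beta0OfJs F κ' k)) : beta0OfJs F κ = beta0OfJs F κ' :=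
  ScaleAnchor.eq_of_smul (b := beta0OfJs F κ) (b' := beta0OfJs F κ') (ne_of_gt hθ.toStage9.chart.1) h h'

/-- … hence the same limit (and the same drifts). [folklore] -/
theorem lim_eq_of_anchors (hθ : θ.Admissible F 2)
    (h : ScaleAnchor (Node00.datumOfRecord₁₃SepCoPH F 2 θ hP).βfun (fun k => θ.cβ * beta0OfJs F κ k))
    (h' : ScaleAnchor (Node00.datumOfRecord₁₃SepCoPH F 2 θ hP).βfun (fun k => θ.cβ * beta0OfJs F κ' k)) :
    CauchyRate.lim (beta0OfJs F κ) = CauchyRate.lim (beta0OfJs F κ') := by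
  rw [beta0OfJs_eq_of_anchors hθ h h']

end Anchors
/-! ## §2 v6's REGISTERED (D1) stub `K2V6Defs.D1AtAnchoredJets` LOCATED: which colour data ANCHOR def-T's records; the dealt use form = colour-blindness -/

section Located

/-- **★ THE REGISTERED 1ᴬ TEXT BY NAME ⟺ «EVERY COLOUR DATUM ANCHORING A PREFIXED ADMISSIBLE RECORD LIES ON THE DRIFT VARIETY `CauchyRate.lim (beta0OfJs F κ) = stepBal 2 F.L`»**
(pointwise §1 (ii); idea-7 §9.2a `d1AtAnchoredJetsK_iff_uvNamable`, here against DEF-1's tree text and N17-free).  READING: a statement about WHICH colour data name def-T's records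
under the crux's prefix — neither a row-(D1) statement at a known member nor decidable from the prefix, whose (B) ∕ window clauses carry no slope information (CRIT-2 ROUND 4 (1)).
[cite: Balaban1987RG1, (2.13) p.268 and (1.3) p.260] -/
theorem d1AtAnchoredJets_iff_anchoredOnVariety :
    D1AtAnchoredJets ↔
      ∀ (F : T4Family) (κ : StepColourData) (θ : Node00.Stage13HParams F 2) (hP : θ.Provisos₁₃SepCoPH F 2),
        (θ.ZhUnity F 2 ∧ θ.SlotsNondegenerate₁₃ F 2) → θ.Admissible F 2 →
        B16.EndStatementBPrinted (Node00.datumOfRecord₁₃SepCoPH F 2 θ hP).C → Window13 F θ hP →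
        ScaleAnchor (Node00.datumOfRecord₁₃SepCoPH F 2 θ hP).βfun (fun k => θ.cβ * beta0OfJs F κ k) →
        CauchyRate.lim (beta0OfJs F κ) = B12Normalization.stepBal 2 F.L :=
  ⟨fun h F κ θ hP hU hθ hB hwin hN => (drift_iff_lim_eq F κ 2).mp (h F κ θ hP hU hθ hB hwin hN),
    fun h F κ θ hP hU hθ hB hwin hN => (drift_iff_lim_eq F κ 2).mpr (h F κ θ hP hU hθ hB hwin hN)⟩

/-- **★ … ⟺ «AT EVERY ANCHORING κ THE NAMED NUMBERS TEND TO BAŁABAN's SLOPE `stepBal 2 F.L`»** — the N17-FREE form of dag-n17-w1's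
`N17D1OfNamedLimit.d1AtAnchoredJets_iff_limitAtAnchoredJets_of_n17AtRecord13` (there GIVEN the `N17AtRecord13` text; §1 (i) makes the rate letter idle). [cite: Balaban1987RG1, (1.3) p.260 and (2.13) p.268] -/
theorem d1AtAnchoredJets_iff_tendstoAtAnchoredJets :
    D1AtAnchoredJets ↔
      ∀ (F : T4Family) (κ : StepColourData) (θ : Node00.Stage13HParams F 2) (hP : θ.Provisos₁₃SepCoPH F 2),
        (θ.ZhUnity F 2 ∧ θ.SlotsNondegenerate₁₃ F 2) → θ.Admissible F 2 →
        B16.EndStatementBPrinted (Node00.datumOfRecord₁₃SepCoPH F 2 θ hP).C → Window13 F θ hP →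
        ScaleAnchor (Node00.datumOfRecord₁₃SepCoPH F 2 θ hP).βfun (fun k => θ.cβ * beta0OfJs F κ k) →
        Tendsto (beta0OfJs F κ) atTop (𝓝 (B12Normalization.stepBal 2 F.L)) :=
  ⟨fun h F κ θ hP hU hθ hB hwin hN => (drift_iff_tendsto_stepBal F κ 2).mp (h F κ θ hP hU hθ hB hwin hN),
    fun h F κ θ hP hU hθ hB hwin hN => (drift_iff_tendsto_stepBal F κ 2).mpr (h F κ θ hP hU hθ hB hwin hN)⟩

/-- **THE JETS-FREE UNIVERSAL CORNER VALUE DISCHARGES 1ᴬ**: if at every tuple carrying the crux's prefix EVERY sequence `b` anchoring the record's β scale by scale tends to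
`θ.cβ · stepBal 2 F.L` (print's «one function β … asymptotic expansions», [I] p. 255, (2.13) p. 268 — a statement about def-T's continuum functional, no named jets, no (P6) datum),
then 1ᴬ (instantiate at `b := θ.cβ • beta0OfJs F κ`, divide the limit by `θ.cβ > 0`).  (idea-7 §9.2c.) [cite: Balaban1987RG1, (2.13) p.268] -/
theorem d1AtAnchoredJets_of_universalCornerValue
    (h : ∀ (F : T4Family) (θ : Node00.Stage13HParams F 2) (hP : θ.Provisos₁₃SepCoPH F 2), (θ.ZhUnity F 2 ∧ θ.SlotsNondegenerate₁₃ F 2) → θ.Admissible F 2 →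
      B16.EndStatementBPrinted (Node00.datumOfRecord₁₃SepCoPH F 2 θ hP).C → Window13 F θ hP →
      ∀ b : ℕ → ℝ, ScaleAnchor (Node00.datumOfRecord₁₃SepCoPH F 2 θ hP).βfun b → Tendsto b atTop (𝓝 (θ.cβ * B12Normalization.stepBal 2 F.L))) :
    D1AtAnchoredJets := fun F κ θ hP hU hθ hB hwin hN =>
  (drift_iff_lim_eq F κ 2).mpr (lim_eq_of_tendsto_smul F κ (ne_of_gt hθ.toStage9.chart.1) (h F θ hP hU hθ hB hwin _ hN))

/-- **… AND AT TUPLES WHERE SOME COLOUR DATUM ANCHORS, 1ᴬ GIVES THE UNIVERSAL CORNER VALUE BACK** (anchor uniqueness `ScaleAnchor.eq` + §1 (i)): jointly with any identification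
stub (2ᴮ″ supplies an anchoring κ per tuple), v6's «(D1) stub» IS a jets-free statement about the record's β — record-side either way.  (idea-7 §9.2d.) [folklore] -/
theorem universalCornerValue_of_d1AtAnchoredJets (h₁ : D1AtAnchoredJets) :
    ∀ (F : T4Family) (θ : Node00.Stage13HParams F 2) (hP : θ.Provisos₁₃SepCoPH F 2), (θ.ZhUnity F 2 ∧ θ.SlotsNondegenerate₁₃ F 2) → θ.Admissible F 2 →
      B16.EndStatementBPrinted (Node00.datumOfRecord₁₃SepCoPH F 2 θ hP).C → Window13 F θ hP →
      (∃ κ : StepColourData, ScaleAnchor (Node00.datumOfRecord₁₃SepCoPH F 2 θ hP).βfun (fun k => θ.cβ * beta0OfJs F κ k)) →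
      ∀ b : ℕ → ℝ, ScaleAnchor (Node00.datumOfRecord₁₃SepCoPH F 2 θ hP).βfun b → Tendsto b atTop (𝓝 (θ.cβ * B12Normalization.stepBal 2 F.L)) := by
  intro F θ hP hU hθ hB hwin hκ b hb
  obtain ⟨κ, hN⟩ := hκ
  have hlim : Tendsto (beta0OfJs F κ) atTop (𝓝 (B12Normalization.stepBal 2 F.L)) :=
    (drift_iff_tendsto_stepBal F κ 2).mp (h₁ F κ θ hP hU hθ hB hwin hN)
  rw [hb.eq hN]
  exact hlim.const_mul θ.cβ

/-- **«(D1) AT EVERY COLOUR DATUM» — the hypothesis of the DEALT use form `d1AtAnchoredJets_of_d1Drift_all` (v6 :369; tree `K2V6Defs.d1AtAnchoredJets_of_drift_of_anchor` with the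
anchor unused) — ⟺ TOTAL COLOUR-BLINDNESS of the one-loop limit: `CauchyRate.lim (beta0OfJs F κ) = stepBal 2 F.L` for ALL `κ ∈ ℝ³ × ℝ × ℝ²⁵⁶`** (pointwise §1 (ii)).  By g1-p1's
`Gaps.D1PinnedColourPolynomial.lim_normalForm_universal` the left member is `γ_r + Φ(c⃗) + cB·σ_r + Λ(Tc)` (Φ quartic without constant∕linear part, Λ linear); colour-blind ⟺
`Φ ≡ 0 ∧ σ_r = 0 ∧ Λ ≡ 0 ∧ γ_r = stepBal 2 F.L` at the centred root — NO coefficient certified either way in the tree (v6 :369's own docstring: «NOT a road»).  (idea-7 §9.2b′.) [folklore] -/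
theorem d1DriftAll_iff_colourBlind :
    (∀ (F : T4Family) (κ : StepColourData), ∃ A : ℝ, OneLoopDrift (B12Normalization.stepBal 2 F.L) A (beta0OfJs F κ)) ↔
      ∀ (F : T4Family) (κ : StepColourData), CauchyRate.lim (beta0OfJs F κ) = B12Normalization.stepBal 2 F.L :=
  forall_congr' fun F => forall_congr' fun κ => drift_iff_lim_eq F κ 2

/-- colour-blindness ⟹ 1ᴬ (the dealt road, end to end, through DEF-1's `d1AtAnchoredJets_of_drift_of_anchor`; the anchor, (B), the window and the unity guard are then idle). [folklore] -/
theorem d1AtAnchoredJets_of_colourBlind (h : ∀ (F : T4Family) (κ : StepColourData), CauchyRate.lim (beta0OfJs F κ) = B12Normalization.stepBal 2 F.L) :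
    D1AtAnchoredJets :=
  d1AtAnchoredJets_of_drift_of_anchor fun F κ _ _ _ _ => (drift_iff_lim_eq F κ 2).mpr (h F κ)

/-- **KILL-TARGET 1 for the dealt road** (a compute ∕ CAP desk's precise object): ONE family and ONE colour datum with `CauchyRate.lim (beta0OfJs F κ) ≠ stepBal 2 F.L` refute
«(D1) at every κ» outright. [folklore] -/
theorem not_d1DriftAll_of_lim_ne {F : T4Family} {κ : StepColourData} (h : CauchyRate.lim (beta0OfJs F κ) ≠ B12Normalization.stepBal 2 F.L) :
    ¬ ∀ (F : T4Family) (κ : StepColourData), ∃ A : ℝ, OneLoopDrift (B12Normalization.stepBal 2 F.L) A (beta0OfJs F κ) :=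
  fun hall => h ((drift_iff_lim_eq F κ 2).mp (hall F κ))

/-- **KILL-TARGET 2**: TWO colour data of ONE family with DIFFERENT one-loop limits (any certified non-constant coefficient of `Φ`, `σ_r` or `Λ`) refute «(D1) at every κ» — no value of
`stepBal` needed. [folklore] -/
theorem not_d1DriftAll_of_lim_ne_lim {F : T4Family} {κ₁ κ₂ : StepColourData} (h : CauchyRate.lim (beta0OfJs F κ₁) ≠ CauchyRate.lim (beta0OfJs F κ₂)) :
    ¬ ∀ (F : T4Family) (κ : StepColourData), ∃ A : ℝ, OneLoopDrift (B12Normalization.stepBal 2 F.L) A (beta0OfJs F κ) :=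
  fun hall => h (((drift_iff_lim_eq F κ₁ 2).mp (hall F κ₁)).trans ((drift_iff_lim_eq F κ₂ 2).mp (hall F κ₂)).symm)

/-- … and the same two targets kill the drift conclusion of 1ᴬ AT THAT κ (so 1ᴬ then says: no prefixed admissible record is anchored by that κ). [folklore] -/
theorem not_drift_of_lim_ne {F : T4Family} {κ : StepColourData} (h : CauchyRate.lim (beta0OfJs F κ) ≠ B12Normalization.stepBal 2 F.L) :
    ¬ ∃ A : ℝ, OneLoopDrift (B12Normalization.stepBal 2 F.L) A (beta0OfJs F κ) :=
  fun hd => h ((drift_iff_lim_eq F κ 2).mp hd)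

end Located
/-! ## §3 v6's PAIR ⟺ ONE ∃κ TEXT (the κ-clause INSIDE the identification), concluding the crux decl BY NAME; the pinned keying -/

section Merged

/-- **★ v6's TWO REGISTERED TEXTS ⟺ ONE ∃κ TEXT «some colour datum ON THE DRIFT VARIETY run-shadows the record»** (→: the drift at the run letter's own κ, via its anchor conjunct;
←: an anchoring κ′ has the run letter's numbers, `lim_eq_of_anchors`).  So 1ᴬ and 2ᴮ″ are one statement split along the identity of κ, which neither owner sees (CRIT-2 ROUND 4 (2);
idea-7 §9.3a). [cite: Balaban1987RG1, Thm 3 p.264 and (2.13) p.268] -/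
theorem stubTexts_iff_runRemAtOnVariety :
    (D1AtAnchoredJets ∧ RunRemAtSomeJets) ↔
      ∀ (F : T4Family) (θ : Node00.Stage13HParams F 2) (hP : θ.Provisos₁₃SepCoPH F 2), (θ.ZhUnity F 2 ∧ θ.SlotsNondegenerate₁₃ F 2) → θ.Admissible F 2 →
        B16.EndStatementBPrinted (Node00.datumOfRecord₁₃SepCoPH F 2 θ hP).C → Window13 F θ hP →
        ∃ κ : StepColourData, CauchyRate.lim (beta0OfJs F κ) = B12Normalization.stepBal 2 F.L ∧ RunRemAt F κ θ hP θ.cβ := by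
  constructor
  · rintro ⟨h₁, h₂⟩ F θ hP hU hθ hB hwin
    obtain ⟨κ, hRun⟩ := h₂ F θ hP hU hθ hB hwin
    have hanch := hRun
    obtain ⟨-, -, -, -, -, -, hanch, -⟩ := hanch
    exact ⟨κ, (drift_iff_lim_eq F κ 2).mp (h₁ F κ θ hP hU hθ hB hwin hanch), hRun⟩
  · intro h
    refine ⟨fun F κ' θ hP hU hθ hB hwin hN => ?_, fun F θ hP hU hθ hB hwin => ?_⟩
    · obtain ⟨κ, hlim, hRun⟩ := h F θ hP hU hθ hB hwin
      obtain ⟨-, -, -, -, -, -, hanch, -⟩ := hRun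
      refine (drift_iff_lim_eq F κ' 2).mpr ?_
      rw [lim_eq_of_anchors hθ hN hanch]
      exact hlim
    · obtain ⟨κ, -, hRun⟩ := h F θ hP hU hθ hB hwin
      exact ⟨κ, hRun⟩

/-- **★★ LINE 1″ — THE ONE MERGED TEXT CONCLUDES THE CRUX DECL BY NAME** (`Summit.QuantumFields.YangMills.Theses.BalabanUVNodes.EndpointGivenBR13SepCoPH`, through DEF-1's
`K2V6Defs.EndpointGivenBR13SepCoPH_of_stubTexts`).  CONDITIONAL on one hypothesis shape; K2⁷ NOT closed; nothing of Bałaban asserted.  (idea-7 §9.3b.)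
[cite: Balaban1987RG1, Thm 2 p.259 (first sentence), Thm 3 p.264 and (2.12)–(2.14) p.268] -/
theorem EndpointGivenBR13SepCoPH_of_runRemAtOnVariety
    (h : ∀ (F : T4Family) (θ : Node00.Stage13HParams F 2) (hP : θ.Provisos₁₃SepCoPH F 2), (θ.ZhUnity F 2 ∧ θ.SlotsNondegenerate₁₃ F 2) → θ.Admissible F 2 →
      B16.EndStatementBPrinted (Node00.datumOfRecord₁₃SepCoPH F 2 θ hP).C → Window13 F θ hP →
      ∃ κ : StepColourData, CauchyRate.lim (beta0OfJs F κ) = B12Normalization.stepBal 2 F.L ∧ RunRemAt F κ θ hP θ.cβ) :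
    Summit.QuantumFields.YangMills.Theses.BalabanUVNodes.EndpointGivenBR13SepCoPH :=
  EndpointGivenBR13SepCoPH_of_stubTexts (stubTexts_iff_runRemAtOnVariety.mpr h).1 (stubTexts_iff_runRemAtOnVariety.mpr h).2

/-- **THE PINNED KEYING's θ-FREE (D1) STUB IS ONE REAL IDENTITY PER BLOCK** (CRIT-2 ROUND 4 re-deal (b): `stub_d1AtPin13 : ∀ F, ∃ A, OneLoopDrift (stepBal 2 F.L) A (beta0OfJs F (κ⋆ F.L))`
with `κ⋆ : ℕ → StepColourData` pinned BEFORE θ): it says `CauchyRate.lim (beta0OfJs F (κ⋆ F.L)) = stepBal 2 F.L` for every family — the evaluation of g1-p1's closed form at the pin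
(`Gaps.D1PinnedNumeral` ∕ `…FiniteDecision`), a β-row item once κ⋆ is committed ((P6): NOT decided anywhere in the tree).  (idea-7 §9.3c.) [folklore] -/
theorem pinnedD1_iff_lim_eq (κ : ℕ → StepColourData) :
    (∀ F : T4Family, ∃ A : ℝ, OneLoopDrift (B12Normalization.stepBal 2 F.L) A (beta0OfJs F (κ F.L))) ↔
      ∀ F : T4Family, CauchyRate.lim (beta0OfJs F (κ F.L)) = B12Normalization.stepBal 2 F.L :=
  forall_congr' fun F => drift_iff_lim_eq F (κ F.L) 2

/-- the pinned keying is a special case of LINE 1″: a pin ON THE DRIFT VARIETY of every family + the run letter AT THE PIN under the crux's prefix ⟹ the merged text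
(the pin is the witness).  (idea-7 §9.3d; cf. DEF-1's `K2V6Defs` v1.1 `…_of_pin` in drift currency.) [folklore] -/
theorem runRemAtOnVariety_of_pin (κ : ℕ → StepColourData) (hD1 : ∀ F : T4Family, CauchyRate.lim (beta0OfJs F (κ F.L)) = B12Normalization.stepBal 2 F.L)
    (hRun : ∀ (F : T4Family) (θ : Node00.Stage13HParams F 2) (hP : θ.Provisos₁₃SepCoPH F 2), (θ.ZhUnity F 2 ∧ θ.SlotsNondegenerate₁₃ F 2) → θ.Admissible F 2 →
      B16.EndStatementBPrinted (Node00.datumOfRecord₁₃SepCoPH F 2 θ hP).C → Window13 F θ hP → RunRemAt F (κ F.L) θ hP θ.cβ) :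
    ∀ (F : T4Family) (θ : Node00.Stage13HParams F 2) (hP : θ.Provisos₁₃SepCoPH F 2), (θ.ZhUnity F 2 ∧ θ.SlotsNondegenerate₁₃ F 2) → θ.Admissible F 2 →
      B16.EndStatementBPrinted (Node00.datumOfRecord₁₃SepCoPH F 2 θ hP).C → Window13 F θ hP →
      ∃ κ : StepColourData, CauchyRate.lim (beta0OfJs F κ) = B12Normalization.stepBal 2 F.L ∧ RunRemAt F κ θ hP θ.cβ :=
  fun F θ hP hU hθ hB hwin => ⟨κ F.L, hD1 F, hRun F θ hP hU hθ hB hwin⟩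

/-- **… and 1ᴬ FOLLOWS from the pin's two statements: the θ-free value `lim = stepBal 2 F.L` AT THE PIN, and «the pin ANCHORS every prefixed admissible record»** (every
other anchoring κ′ shares the pin's numbers) — the second is the identification, record content again.  (idea-7 §9.3e.) [folklore] -/
theorem d1AtAnchoredJets_of_pinOnVariety (κ : ℕ → StepColourData) (hD1 : ∀ F : T4Family, CauchyRate.lim (beta0OfJs F (κ F.L)) = B12Normalization.stepBal 2 F.L)
    (hN : ∀ (F : T4Family) (θ : Node00.Stage13HParams F 2) (hP : θ.Provisos₁₃SepCoPH F 2), (θ.ZhUnity F 2 ∧ θ.SlotsNondegenerate₁₃ F 2) → θ.Admissible F 2 →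
      B16.EndStatementBPrinted (Node00.datumOfRecord₁₃SepCoPH F 2 θ hP).C → Window13 F θ hP →
      ScaleAnchor (Node00.datumOfRecord₁₃SepCoPH F 2 θ hP).βfun (fun k => θ.cβ * beta0OfJs F (κ F.L) k)) :
    D1AtAnchoredJets := fun F κ' θ hP hU hθ hB hwin hN' =>
  (drift_iff_lim_eq F κ' 2).mpr ((lim_eq_of_anchors hθ hN' (hN F θ hP hU hθ hB hwin)).trans (hD1 F))

end Merged
/-! ## §4 The SIGN keying over PORT-1's corner road (`K2CornerRoad`, p599976) — the END accepts any positive slope; §1 (i) removes the rate letter from the sign junction -/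

section Sign

/-- **1ᴬ ⟹ PORT-1's Signᴷ text, U3-FREE**: at every anchoring κ under the prefix the named numbers are eventually ≥ some `e > 0` (drift ⟹ `lim = stepBal 2 F.L > 0` ⟹ floor `lim∕2`;
PORT-1's `signK_of_u3K_d1AnchoredK` needed U3ᴷ only for convergence, which §1 (i) gives hypothesis-free).  The window is spelled unfolded, as PORT-1 and the crux decl spell it
(`K2V6Defs.window13_iff` = `Iff.rfl`). [cite: Balaban1987RG1, (1.3) p.260] -/
theorem signK_of_d1AtAnchoredJets (h₁ : D1AtAnchoredJets) :
    ∀ (F : T4Family) (κ : StepColourData) (θ : Node00.Stage13HParams F 2) (hP : θ.Provisos₁₃SepCoPH F 2), (θ.ZhUnity F 2 ∧ θ.SlotsNondegenerate₁₃ F 2) → θ.Admissible F 2 →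
      B16.EndStatementBPrinted (Node00.datumOfRecord₁₃SepCoPH F 2 θ hP).C → (∃ γ₁ : ℝ, 0 < γ₁ ∧ ∀ γ : ℝ, 0 < γ → γ ≤ γ₁ → ∃ P : B12.RunParams, 1 ≤ P.K ∧ ((Node00.datumOfRecord₁₃SepCoPH F 2 θ hP).C P).flow.InInterval γ P.K) →
      ScaleAnchor (Node00.datumOfRecord₁₃SepCoPH F 2 θ hP).βfun (fun k => θ.cβ * beta0OfJs F κ k) →
      ∃ e : ℝ, 0 < e ∧ ∃ k₀ : ℕ, ∀ k, k₀ ≤ k → e ≤ beta0OfJs F κ k := fun F κ θ hP hU hθ hB hwin hN => by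
  obtain ⟨A, hd⟩ := h₁ F κ θ hP hU hθ hB hwin hN
  exact eventuallyPos_of_drift F κ hd

/-- **Anchor-Positiveᴷ ⟹ Signᴷ**: if at every prefixed tuple SOME colour datum with POSITIVE one-loop limit anchors the record, then EVERY anchoring κ′ there has eventually positive
numbers (κ′ shares κ's numbers, `lim_eq_of_anchors`; floor `lim∕2` from §1 (i)). [folklore] -/
theorem signK_of_anchorPositiveK
    (hA : ∀ (F : T4Family) (θ : Node00.Stage13HParams F 2) (hP : θ.Provisos₁₃SepCoPH F 2), (θ.ZhUnity F 2 ∧ θ.SlotsNondegenerate₁₃ F 2) → θ.Admissible F 2 →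
      B16.EndStatementBPrinted (Node00.datumOfRecord₁₃SepCoPH F 2 θ hP).C → (∃ γ₁ : ℝ, 0 < γ₁ ∧ ∀ γ : ℝ, 0 < γ → γ ≤ γ₁ → ∃ P : B12.RunParams, 1 ≤ P.K ∧ ((Node00.datumOfRecord₁₃SepCoPH F 2 θ hP).C P).flow.InInterval γ P.K) →
      ∃ κ : StepColourData, 0 < CauchyRate.lim (beta0OfJs F κ) ∧ ScaleAnchor (Node00.datumOfRecord₁₃SepCoPH F 2 θ hP).βfun (fun k => θ.cβ * beta0OfJs F κ k)) :
    ∀ (F : T4Family) (κ : StepColourData) (θ : Node00.Stage13HParams F 2) (hP : θ.Provisos₁₃SepCoPH F 2), (θ.ZhUnity F 2 ∧ θ.SlotsNondegenerate₁₃ F 2) → θ.Admissible F 2 →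
      B16.EndStatementBPrinted (Node00.datumOfRecord₁₃SepCoPH F 2 θ hP).C → (∃ γ₁ : ℝ, 0 < γ₁ ∧ ∀ γ : ℝ, 0 < γ → γ ≤ γ₁ → ∃ P : B12.RunParams, 1 ≤ P.K ∧ ((Node00.datumOfRecord₁₃SepCoPH F 2 θ hP).C P).flow.InInterval γ P.K) →
      ScaleAnchor (Node00.datumOfRecord₁₃SepCoPH F 2 θ hP).βfun (fun k => θ.cβ * beta0OfJs F κ k) →
      ∃ e : ℝ, 0 < e ∧ ∃ k₀ : ℕ, ∀ k, k₀ ≤ k → e ≤ beta0OfJs F κ k := fun F κ' θ hP hU hθ hB hwin hN' => by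
  obtain ⟨κ, hpos, hN⟩ := hA F θ hP hU hθ hB hwin
  apply eventuallyPos_of_lim_pos
  rw [lim_eq_of_anchors hθ hN' hN]
  exact hpos

/-- **★★ LINE 2″ — THE CORNER ROAD'S SIGN EDITION, concluding THE CRUX DECL BY NAME: U3ᴷ → Anchor-Positiveᴷ → `EndpointGivenBR13SepCoPH`** (PORT-1's
`EndpointGivenBR13SepCoPH_of_u3K_anchorK_signK` with Signᴷ supplied by `signK_of_anchorPositiveK` and Anchorᴷ by projection: on K3⁷'s letters LINE 2″ asks the SIGN of the one-loop
limit at an anchoring κ where LINE 1′ asks its VALUE).  CONDITIONAL on two hypothesis shapes; K2⁷ NOT closed; nothing of Bałaban asserted.  (idea-7 §9.4a.)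
[cite: Balaban1987RG1, Thm 2 p.259 (first sentence), (1.20)–(1.22) p.264 and (2.13) p.268] -/
theorem EndpointGivenBR13SepCoPH_of_u3K_anchorPositiveK
    (hU3 : ∀ (F : T4Family) (θ : Node00.Stage13HParams F 2) (hP : θ.Provisos₁₃SepCoPH F 2), (θ.ZhUnity F 2 ∧ θ.SlotsNondegenerate₁₃ F 2) → θ.Admissible F 2 →
      B16.EndStatementBPrinted (Node00.datumOfRecord₁₃SepCoPH F 2 θ hP).C → (∃ γ₁ : ℝ, 0 < γ₁ ∧ ∀ γ : ℝ, 0 < γ → γ ≤ γ₁ → ∃ P : B12.RunParams, 1 ≤ P.K ∧ ((Node00.datumOfRecord₁₃SepCoPH F 2 θ hP).C P).flow.InInterval γ P.K) →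
      ∃ (c C ρ : ℝ) (Λ : ℕ → ℕ → ℝ), 0 ≤ c ∧ 0 < ρ ∧ ρ < 1 ∧ ScaleShiftRate c ρ θ.γ (Node00.datumOfRecord₁₃SepCoPH F 2 θ hP).βfun ∧
        HistLipschitz Λ θ.γ (Node00.datumOfRecord₁₃SepCoPH F 2 θ hP).βfun ∧ T4CouplingMatching.FadingMemory C ρ Λ)
    (hA : ∀ (F : T4Family) (θ : Node00.Stage13HParams F 2) (hP : θ.Provisos₁₃SepCoPH F 2), (θ.ZhUnity F 2 ∧ θ.SlotsNondegenerate₁₃ F 2) → θ.Admissible F 2 →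
      B16.EndStatementBPrinted (Node00.datumOfRecord₁₃SepCoPH F 2 θ hP).C → (∃ γ₁ : ℝ, 0 < γ₁ ∧ ∀ γ : ℝ, 0 < γ → γ ≤ γ₁ → ∃ P : B12.RunParams, 1 ≤ P.K ∧ ((Node00.datumOfRecord₁₃SepCoPH F 2 θ hP).C P).flow.InInterval γ P.K) →
      ∃ κ : StepColourData, 0 < CauchyRate.lim (beta0OfJs F κ) ∧ ScaleAnchor (Node00.datumOfRecord₁₃SepCoPH F 2 θ hP).βfun (fun k => θ.cβ * beta0OfJs F κ k)) :
    Summit.QuantumFields.YangMills.Theses.BalabanUVNodes.EndpointGivenBR13SepCoPH :=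
  EndpointGivenBR13SepCoPH_of_u3K_anchorK_signK hU3
    (fun F θ hP hU hθ hB hwin => by
      obtain ⟨κ, -, hN⟩ := hA F θ hP hU hθ hB hwin
      exact ⟨κ, hN⟩)
    (signK_of_anchorPositiveK hA)

/-- **★ Anchor-Positiveᴷ ⟺ Anchorᴷ ∧ Corner-Signᴷ** — the sign edition's extra conjunct is EXACTLY «at anchored tuples every anchoring sequence has a positive limit» (anchor uniqueness
`ScaleAnchor.eq` + §1 (i); no U3 letter).  (idea-7 §9.4b, `CornerAnchor` replaced by DEF-1's `ScaleAnchor` as PORT-1 re-based it.) [folklore] -/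
theorem anchorPositiveK_iff_anchorSomeK_and_cornerSign :
    (∀ (F : T4Family) (θ : Node00.Stage13HParams F 2) (hP : θ.Provisos₁₃SepCoPH F 2), (θ.ZhUnity F 2 ∧ θ.SlotsNondegenerate₁₃ F 2) → θ.Admissible F 2 →
      B16.EndStatementBPrinted (Node00.datumOfRecord₁₃SepCoPH F 2 θ hP).C → (∃ γ₁ : ℝ, 0 < γ₁ ∧ ∀ γ : ℝ, 0 < γ → γ ≤ γ₁ → ∃ P : B12.RunParams, 1 ≤ P.K ∧ ((Node00.datumOfRecord₁₃SepCoPH F 2 θ hP).C P).flow.InInterval γ P.K) →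
      ∃ κ : StepColourData, 0 < CauchyRate.lim (beta0OfJs F κ) ∧ ScaleAnchor (Node00.datumOfRecord₁₃SepCoPH F 2 θ hP).βfun (fun k => θ.cβ * beta0OfJs F κ k)) ↔
    ((∀ (F : T4Family) (θ : Node00.Stage13HParams F 2) (hP : θ.Provisos₁₃SepCoPH F 2), (θ.ZhUnity F 2 ∧ θ.SlotsNondegenerate₁₃ F 2) → θ.Admissible F 2 →
      B16.EndStatementBPrinted (Node00.datumOfRecord₁₃SepCoPH F 2 θ hP).C → (∃ γ₁ : ℝ, 0 < γ₁ ∧ ∀ γ : ℝ, 0 < γ → γ ≤ γ₁ → ∃ P : B12.RunParams, 1 ≤ P.K ∧ ((Node00.datumOfRecord₁₃SepCoPH F 2 θ hP).C P).flow.InInterval γ P.K) →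
      ∃ κ : StepColourData, ScaleAnchor (Node00.datumOfRecord₁₃SepCoPH F 2 θ hP).βfun (fun k => θ.cβ * beta0OfJs F κ k)) ∧
     (∀ (F : T4Family) (θ : Node00.Stage13HParams F 2) (hP : θ.Provisos₁₃SepCoPH F 2), (θ.ZhUnity F 2 ∧ θ.SlotsNondegenerate₁₃ F 2) → θ.Admissible F 2 →
      B16.EndStatementBPrinted (Node00.datumOfRecord₁₃SepCoPH F 2 θ hP).C → (∃ γ₁ : ℝ, 0 < γ₁ ∧ ∀ γ : ℝ, 0 < γ → γ ≤ γ₁ → ∃ P : B12.RunParams, 1 ≤ P.K ∧ ((Node00.datumOfRecord₁₃SepCoPH F 2 θ hP).C P).flow.InInterval γ P.K) →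
      (∃ κ : StepColourData, ScaleAnchor (Node00.datumOfRecord₁₃SepCoPH F 2 θ hP).βfun (fun k => θ.cβ * beta0OfJs F κ k)) →
      ∀ b : ℕ → ℝ, ScaleAnchor (Node00.datumOfRecord₁₃SepCoPH F 2 θ hP).βfun b → ∀ binf : ℝ, Tendsto b atTop (𝓝 binf) → 0 < binf)) := by
  constructor
  · intro h
    refine ⟨fun F θ hP hU hθ hB hwin => ?_, fun F θ hP hU hθ hB hwin _ b hb binf hlim => ?_⟩
    · obtain ⟨κ, -, hN⟩ := h F θ hP hU hθ hB hwin
      exact ⟨κ, hN⟩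
    · obtain ⟨κ, hpos, hN⟩ := h F θ hP hU hθ hB hwin
      have hlim' : Tendsto b atTop (𝓝 (θ.cβ * CauchyRate.lim (beta0OfJs F κ))) := by
        rw [hb.eq hN]
        exact (tendsto_beta0OfJs F κ).const_mul θ.cβ
      rw [tendsto_nhds_unique hlim hlim']
      exact mul_pos hθ.toStage9.chart.1 hpos
  · rintro ⟨hA, hs⟩ F θ hP hU hθ hB hwin
    obtain ⟨κ, hN⟩ := hA F θ hP hU hθ hB hwin
    have hpos : 0 < θ.cβ * CauchyRate.lim (beta0OfJs F κ) :=
      hs F θ hP hU hθ hB hwin ⟨κ, hN⟩ _ hN _ ((tendsto_beta0OfJs F κ).const_mul θ.cβ)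
    exact ⟨κ, (mul_pos_iff_of_pos_left hθ.toStage9.chart.1).mp hpos, hN⟩

/-- value ⟹ sign: the merged LINE 1″ text ⟹ Anchor-Positiveᴷ (`0 < stepBal 2 F.L`; the run letter's anchor conjunct).  (idea-7 §9.4c.) [folklore] -/
theorem anchorPositiveK_of_runRemAtOnVariety
    (h : ∀ (F : T4Family) (θ : Node00.Stage13HParams F 2) (hP : θ.Provisos₁₃SepCoPH F 2), (θ.ZhUnity F 2 ∧ θ.SlotsNondegenerate₁₃ F 2) → θ.Admissible F 2 →
      B16.EndStatementBPrinted (Node00.datumOfRecord₁₃SepCoPH F 2 θ hP).C → Window13 F θ hP →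
      ∃ κ : StepColourData, CauchyRate.lim (beta0OfJs F κ) = B12Normalization.stepBal 2 F.L ∧ RunRemAt F κ θ hP θ.cβ) :
    ∀ (F : T4Family) (θ : Node00.Stage13HParams F 2) (hP : θ.Provisos₁₃SepCoPH F 2), (θ.ZhUnity F 2 ∧ θ.SlotsNondegenerate₁₃ F 2) → θ.Admissible F 2 →
      B16.EndStatementBPrinted (Node00.datumOfRecord₁₃SepCoPH F 2 θ hP).C → (∃ γ₁ : ℝ, 0 < γ₁ ∧ ∀ γ : ℝ, 0 < γ → γ ≤ γ₁ → ∃ P : B12.RunParams, 1 ≤ P.K ∧ ((Node00.datumOfRecord₁₃SepCoPH F 2 θ hP).C P).flow.InInterval γ P.K) →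
      ∃ κ : StepColourData, 0 < CauchyRate.lim (beta0OfJs F κ) ∧ ScaleAnchor (Node00.datumOfRecord₁₃SepCoPH F 2 θ hP).βfun (fun k => θ.cβ * beta0OfJs F κ k) :=
  fun F θ hP hU hθ hB hwin => by
  obtain ⟨κ, hlim, hRun⟩ := h F θ hP hU hθ hB hwin
  obtain ⟨-, -, -, -, -, -, hanch, -⟩ := hRun
  refine ⟨κ, ?_, hanch⟩
  rw [hlim]
  exact stepBal_L_pos F two_pos

/-- … in particular v6's registered PAIR ⟹ Anchor-Positiveᴷ. [folklore] -/
theorem anchorPositiveK_of_stubTexts (h₁ : D1AtAnchoredJets) (h₂ : RunRemAtSomeJets) :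
    ∀ (F : T4Family) (θ : Node00.Stage13HParams F 2) (hP : θ.Provisos₁₃SepCoPH F 2), (θ.ZhUnity F 2 ∧ θ.SlotsNondegenerate₁₃ F 2) → θ.Admissible F 2 →
      B16.EndStatementBPrinted (Node00.datumOfRecord₁₃SepCoPH F 2 θ hP).C → (∃ γ₁ : ℝ, 0 < γ₁ ∧ ∀ γ : ℝ, 0 < γ → γ ≤ γ₁ → ∃ P : B12.RunParams, 1 ≤ P.K ∧ ((Node00.datumOfRecord₁₃SepCoPH F 2 θ hP).C P).flow.InInterval γ P.K) →
      ∃ κ : StepColourData, 0 < CauchyRate.lim (beta0OfJs F κ) ∧ ScaleAnchor (Node00.datumOfRecord₁₃SepCoPH F 2 θ hP).βfun (fun k => θ.cβ * beta0OfJs F κ k) :=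
  anchorPositiveK_of_runRemAtOnVariety (stubTexts_iff_runRemAtOnVariety.mp ⟨h₁, h₂⟩)

end Sign

end Summit.QuantumFields.YangMills.Theorems.BalabanUVNodesK2NamedJetsLimit

end
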